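import Mathlib.Analysis.Calculus.DifferentialForm.Basic
import Mathlib.Analysis.Normed.Module.Alternating.Curry
import Mathlib.Analysis.Calculus.FDeriv.CompCLM
import Mathlib.MeasureTheory.Integral.IntervalIntegral.FundThmCalculus
import Mathlib.Analysis.SpecialFunctions.Pow.Deriv
import HarnessLib

/-!
# Cartan's formula for the Euler vector field and the ray identity

Pure calculus of differential forms on a real normed space (Mathlib's `extDeriv`,
`ContinuousAlternatingMap.curryLeft` as the interior product), towards the homotopy formula for
the dilations `μ_t(x) = t x` [Federer1969, 4.1.9] (`ConeHomotopy.lean`):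

* `isBoundedBilinearMap_curryLeft`, `hasFDerivAt_curryLeft_self`, `fderiv_curryLeft_self_apply`
  — the interior product `(f, y) ↦ ι_y f` is bounded bilinear, so `x ↦ ι_x ψ(x)` is differentiable
  with `D(ι_X ψ)(x)(h) = ι_h ψ(x) + ι_x Dψ(x)(h)`;
* `extDeriv_curryLeft_self_add` (`'`) — **Cartan's formula for the Euler vector field**
  `X(x) = x` on `(k+1)`-forms, pointwise: `d(ι_X ψ)(x) + ι_x dψ(x) = (k+1) ψ(x) + Dψ(x)(x)`
  (`= ℒ_X ψ`, since `DX = id`), from the coordinate formula `extDeriv_apply`;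
* `sub_pow_smul_apply_smul_eq_integral` — **the ray identity** for a `C¹` form:
  `ψ(y) − s^{k+1} ψ(s y) = ∫_s^1 [tᵏ d(ι_X ψ)(t y) + t^{k+1} ι_y dψ(t y)] dt`, i.e.
  `μ_1^*ψ − μ_s^*ψ = ∫_s^1 t⁻¹ μ_t^*(d ι_X ψ + ι_X dψ) dt` (fundamental theorem of calculus along
  rays applied to `t ↦ t^{k+1} ψ(t y)`).

No definitions, no named facts; Mathlib-only imports.

## References

* H. Federer, *Geometric Measure Theory*, Springer 1969, 4.1.6, 4.1.9 [Federer1969].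
* H. Cartan's formula `ℒ_X = d ι_X + ι_X d` (any differential geometry text) [folklore].
-/

open Filter
open scoped Topology

namespace Literature.Geometry.GeometricMeasureTheory

section Cartan

variable {V : Type*} [NormedAddCommGroup V] [NormedSpace ℝ V] {F : Type*} [NormedAddCommGroup F]
  [NormedSpace ℝ F] {k : ℕ}

omit [NormedAddCommGroup V] [NormedSpace ℝ V] in
/-- Removing the `(j+1)`-st entry of `(x, v₀, …, v_k)` gives `x` followed by `v` with its `j`-th
entry removed. [folklore] -/
theorem removeNth_succ_vecCons (x : V) (v : Fin (k + 1) → V) (j : Fin (k + 1)) :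
    j.succ.removeNth (Matrix.vecCons x v) = Matrix.vecCons x (j.removeNth v) := by
  funext i
  refine Fin.cases ?_ (fun i => ?_) i
  · simp [Fin.removeNth]
  · simp [Fin.removeNth, Fin.succ_succAbove_succ]

/-- The interior product `(f, y) ↦ ι_y f` is a bounded bilinear map. [folklore] -/
theorem isBoundedBilinearMap_curryLeft :
    IsBoundedBilinearMap ℝ (fun p : (V [⋀^Fin (k + 1)]→L[ℝ] F) × V => p.1.curryLeft p.2) where
  add_left := fun f g y => by simp
  smul_left := fun c f y => by simp
  add_right := fun f y z => by simp
  smul_right := fun c f y => by simp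
  bound := ⟨1, one_pos, fun f y => by
    simpa [ContinuousAlternatingMap.norm_curryLeft] using (f.curryLeft).le_opNorm y⟩

/-- The interior product with the position vector, `x ↦ ι_x (ψ x)`, is differentiable where `ψ`
is, with derivative `h ↦ ι_h (ψ x) + ι_x (Dψ(x) h)`. [folklore] -/
theorem hasFDerivAt_curryLeft_self (ψ : V → V [⋀^Fin (k + 1)]→L[ℝ] F) {x : V}
    (hψ : DifferentiableAt ℝ ψ x) :
    HasFDerivAt (fun y => (ψ y).curryLeft y)
      ((isBoundedBilinearMap_curryLeft (V := V) (F := F) (k := k)).deriv (ψ x, x) ∘L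
        ((fderiv ℝ ψ x).prod (ContinuousLinearMap.id ℝ V))) x := by
  have h2 : HasFDerivAt (fun y => (ψ y, y)) ((fderiv ℝ ψ x).prod (ContinuousLinearMap.id ℝ V)) x :=
    hψ.hasFDerivAt.prodMk (hasFDerivAt_id x)
  exact HasFDerivAt.comp x (f := fun y => (ψ y, y))
    (isBoundedBilinearMap_curryLeft.hasFDerivAt (ψ x, x)) h2

/-- Value of the derivative of `x ↦ ι_x (ψ x)`: `D(ι ψ)(x)(h)(u) = ψ(x)(h, u) + Dψ(x)(h)(x, u)`.
[folklore] -/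
theorem fderiv_curryLeft_self_apply (ψ : V → V [⋀^Fin (k + 1)]→L[ℝ] F) {x : V}
    (hψ : DifferentiableAt ℝ ψ x) (h : V) (u : Fin k → V) :
    fderiv ℝ (fun y => (ψ y).curryLeft y) x h u =
      ψ x (Matrix.vecCons h u) + fderiv ℝ ψ x h (Matrix.vecCons x u) := by
  rw [(hasFDerivAt_curryLeft_self ψ hψ).fderiv]
  simp [IsBoundedBilinearMap.deriv_apply]

/-- **Cartan's formula for the Euler vector field** `X(x) = x` on `(k+1)`-forms, pointwise:
`d(ι_X ψ)(x)(v) + (ι_X dψ)(x)(v) = (k + 1) ψ(x)(v) + (∇_x ψ)(x)(v)`, i.e.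
`ℒ_X ψ = d ι_X ψ + ι_X dψ` with `ℒ_X ψ = ∇_X ψ + (k+1) ψ` (since `DX = id`). [folklore] -/
theorem extDeriv_curryLeft_self_add (ψ : V → V [⋀^Fin (k + 1)]→L[ℝ] F) {x : V}
    (hψ : DifferentiableAt ℝ ψ x) (v : Fin (k + 1) → V) :
    extDeriv (fun y => (ψ y).curryLeft y) x v + extDeriv ψ x (Matrix.vecCons x v) =
      ((k : ℝ) + 1) • ψ x v + fderiv ℝ ψ x x v := by
  have hι : DifferentiableAt ℝ (fun y => (ψ y).curryLeft y) x :=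
    (hasFDerivAt_curryLeft_self ψ hψ).differentiableAt
  -- `(ι_X dψ)(x)(v)`: the `i = 0` term is `∇_x ψ (v)`, the others pair with `d(ι_X ψ)`
  have hA : extDeriv ψ x (Matrix.vecCons x v) = fderiv ℝ ψ x x v +
      ∑ j : Fin (k + 1), -((-1 : ℤ) ^ (j : ℕ) •
        fderiv ℝ ψ x (v j) (Matrix.vecCons x (j.removeNth v))) := by
    rw [extDeriv_apply hψ, Fin.sum_univ_succ]
    congr 1
    · rw [fderiv_continuousAlternatingMap_apply_const_apply hψ]
      simp
    · refine Finset.sum_congr rfl fun j _ => ?_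
      rw [fderiv_continuousAlternatingMap_apply_const_apply hψ, Matrix.cons_val_succ,
        removeNth_succ_vecCons, Fin.val_succ, pow_succ, mul_neg, mul_one, neg_smul]
  have hB : extDeriv (fun y => (ψ y).curryLeft y) x v =
      ∑ j : Fin (k + 1), (-1 : ℤ) ^ (j : ℕ) • (ψ x (Matrix.vecCons (v j) (j.removeNth v)) +
        fderiv ℝ ψ x (v j) (Matrix.vecCons x (j.removeNth v))) := by
    rw [extDeriv_apply hι]
    refine Finset.sum_congr rfl fun j _ => ?_
    rw [fderiv_continuousAlternatingMap_apply_const_apply hι, fderiv_curryLeft_self_apply ψ hψ]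
  have hC : ∀ j : Fin (k + 1),
      (-1 : ℤ) ^ (j : ℕ) • ψ x (Matrix.vecCons (v j) (j.removeNth v)) = ψ x v := by
    intro j
    have h := ContinuousAlternatingMap.map_insertNth (ψ x) j (v j) (j.removeNth v)
    rw [Fin.insertNth_self_removeNth] at h
    rw [h]
  rw [hA, hB]
  simp only [smul_add, Finset.sum_add_distrib, hC, Finset.sum_const, Finset.card_univ,
    Fintype.card_fin, Finset.sum_neg_distrib]
  rw [← Nat.cast_smul_eq_nsmul ℝ, Nat.cast_succ]
  abel

/-- Cartan's formula for the Euler field, as an identity of `(k+1)`-covectors: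
`d(ι_X ψ)(x) + ι_x(dψ(x)) = (k+1) ψ(x) + Dψ(x)(x)`. [folklore] -/
theorem extDeriv_curryLeft_self_add' (ψ : V → V [⋀^Fin (k + 1)]→L[ℝ] F) {x : V}
    (hψ : DifferentiableAt ℝ ψ x) :
    extDeriv (fun y => (ψ y).curryLeft y) x + (extDeriv ψ x).curryLeft x =
      ((k : ℝ) + 1) • ψ x + fderiv ℝ ψ x x := by
  ext v
  simpa using extDeriv_curryLeft_self_add ψ hψ v

end Cartan

/-! ### The Euler identity along rays -/

section Ray

variable {V : Type*} [NormedAddCommGroup V] [NormedSpace ℝ V] {F : Type*} [NormedAddCommGroup F]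
  [NormedSpace ℝ F] [CompleteSpace F] {k : ℕ}

/-- **The ray identity** (the homotopy formula for the dilations `μ_t(y) = t y`, integrated from
`s` to `1`, at the level of forms): for a `C¹` `(k+1)`-form `ψ`,
`ψ(y) − s^{k+1} ψ(s y) = ∫_s^1 [tᵏ d(ι_X ψ)(t y) + t^{k+1} ι_y dψ(t y)] dt`,
i.e. `μ_1^*ψ − μ_s^*ψ = ∫_s^1 t⁻¹ μ_t^*(d ι_X ψ + ι_X dψ) dt` (Cartan: `ℒ_X = d ι_X + ι_X d`).
[cite: Federer1969, 4.1.9] -/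
theorem sub_pow_smul_apply_smul_eq_integral (ψ : V → V [⋀^Fin (k + 1)]→L[ℝ] F)
    (hψ : ContDiff ℝ 1 ψ) (y : V) (s : ℝ) :
    ψ y - s ^ (k + 1) • ψ (s • y) =
      ∫ t in s..1, (t ^ k • extDeriv (fun z => (ψ z).curryLeft z) (t • y) +
        t ^ (k + 1) • (extDeriv ψ (t • y)).curryLeft y) := by
  have hdiff : Differentiable ℝ ψ := hψ.differentiable one_ne_zero
  -- `G(t) = t^{k+1} ψ(t y)` and its derivative
  have hd : ∀ t : ℝ, HasDerivAt (fun t : ℝ => t ^ (k + 1) • ψ (t • y))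
      (t ^ (k + 1) • fderiv ℝ ψ (t • y) y + (((k : ℝ) + 1) * t ^ k) • ψ (t • y)) t := by
    intro t
    have h1 := (hdiff (t • y)).hasFDerivAt.comp_hasDerivAt t ((hasDerivAt_id t).smul_const y)
    have h2 := hasDerivAt_pow (k + 1) t
    have h3 := h2.smul h1
    simp only [Function.comp_def, id, one_smul, Nat.cast_add, Nat.cast_one,
      Nat.add_sub_cancel] at h3
    exact h3
  have hcont : Continuous (fun t : ℝ =>
      t ^ (k + 1) • fderiv ℝ ψ (t • y) y + (((k : ℝ) + 1) * t ^ k) • ψ (t • y)) := by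
    have hc1 : Continuous (fun t : ℝ => fderiv ℝ ψ (t • y) y) :=
      ((hψ.continuous_fderiv one_ne_zero).comp (continuous_id.smul continuous_const)).clm_apply
        continuous_const
    have hc2 : Continuous (fun t : ℝ => ψ (t • y)) :=
      hψ.continuous.comp (continuous_id.smul continuous_const)
    exact ((continuous_pow (k + 1)).smul hc1).add
      ((continuous_const.mul (continuous_pow k)).smul hc2)
  have hftc := intervalIntegral.integral_eq_sub_of_hasDerivAt (fun t _ => hd t)
    (hcont.intervalIntegrable s 1)
  simp only [one_pow, one_smul] at hftc
  rw [← hftc]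
  refine intervalIntegral.integral_congr fun t _ => ?_
  -- pointwise: Cartan's formula at `x = t • y`
  have hC := extDeriv_curryLeft_self_add' ψ (hdiff (t • y))
  have hcurry : (extDeriv ψ (t • y)).curryLeft (t • y) = t • (extDeriv ψ (t • y)).curryLeft y :=
    map_smul _ _ _
  have hfd : fderiv ℝ ψ (t • y) (t • y) = t • fderiv ℝ ψ (t • y) y := map_smul _ _ _
  rw [hcurry, hfd] at hC
  -- hC : dι(ty) + t • ι_y dψ(ty) = (k+1) • ψ(ty) + t • Dψ(ty) y
  calc t ^ (k + 1) • fderiv ℝ ψ (t • y) y + (((k : ℝ) + 1) * t ^ k) • ψ (t • y)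
      = t ^ k • (((k : ℝ) + 1) • ψ (t • y) + t • fderiv ℝ ψ (t • y) y) := by
        rw [smul_add, smul_smul, smul_smul, pow_succ, mul_comm (((k : ℝ) + 1))]
        abel
    _ = t ^ k • (extDeriv (fun z => (ψ z).curryLeft z) (t • y) +
          t • (extDeriv ψ (t • y)).curryLeft y) := by rw [hC]
    _ = t ^ k • extDeriv (fun z => (ψ z).curryLeft z) (t • y) +
          t ^ (k + 1) • (extDeriv ψ (t • y)).curryLeft y := by
        rw [smul_add, smul_smul, pow_succ]

end Ray

end Literature.Geometry.GeometricMeasureTheory
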